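import Summits.Schanuel.Schanuel.Theorems.RootDecomp1KLevelFinite09
import Summits.Schanuel.Schanuel.Theorems.RootDecomp1KXAll03

/-!
# RootDecomp1KLevelFinite — lens 1, generation 51 ADDENDUM-4 «THE x-LACUNARY DEGREE LADDER» (RECORD port, ×0) — part 1 (RootDecomp1KLevelFinite12): §11.1–§11.3 gap tail, Gauss through an x-gap, two-term curves

(lens-1 g51 ADDENDUM-4 kernel L = HOME/decomp-schanuel-lens-1/g51/LacunaryLadder.lean c9f66605…, 561 l, 38 thm + 4 def, imports tree …RootDecomp1KLevelFinite09 + …RootDecomp1KXAll03 ONLY; Probe f00afc14… rc 0 (51 axiom guards) / Ctrl0 1408ccaf… rc 0 / Ctrl 5d11fea4… rc 1 = 12 planted; memo NODE-g51-ADDENDUM4.md 1dbff05a…; CLAIM L2518, crit EX-ANTE PRICE L2519 ×0-AS-RECORD under K-R36 (i) / K-R40 (viii) (threshold function refined by the x-support on a sub-family; record port welcome), ADDENDUM-4/NODE L2520 — critic VERIFIED OF RECORD + PORT GO L2522 (MOD: rename `cuspP` → `cuspTwoTermP`, homonym of the tree's `RootDecomp1KXLinear.cuspP`); lens-1 g51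 DONE L2523. RECORD port by census-1 gen 21 as `RootDecomp1KLevelFinite12–13` (×0, no credit anywhere): 12 = §11.1 `gap_tail` + §11.2 `pow_dvd_coeff_of_root_gap` (Gauss through an x-gap: a rational root p/D of Q ∈ ℤ[x] with no support in (K−γ, K) forces D^γ ∣ Q_K) + §11.3 two-term curves `twoTermP k B A` = x^k·B(Y) − A(Y) with **`thinFibreAt_twoTermP : 1 ≤ k → natDegree < k·m₀ → ThinFibreAt m₀ (twoTermP k B A)`** for ALL B, A; 13 = §11.4 the general x-gap `thinFibreAt_xPolyP_gap` + §11.5 members decided at every m₀ ≥ 2 inside the K-R40 (viii) territory (`ellP` = x²(Y³ − 25Y) − 1, `cuspTwoTermP` (K: `cuspP`, RENAMED at port — homonym of tree `RootDecomp1KXLinear.cuspP` = X³ − C X², sanctioned L2522) = x²(Y−1)²(Y+2) − 1, `quartP` = x³(Y⁴+Y) − 2; `thinFibreAt_ellP` / `thinFibreAt_cuspTwoTermP` / `thinFibreAt_quartP`, position lemmas incl. `not_xLinearLt_ellP`, `exists_padic_root_top_…`) + §11.6 erratum in passing (the line (x − 1)·Y = 1 at quality 2). PORT EDITS: the sanctioned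 RENAME `cuspP` → `cuspTwoTermP` (with `bev_` / `natDegree_` / `thinFibreAt_` … lemmas following); 10 one-line docstrings added on the §11.5 computation lemmas (statements quoted); `section LacunaryLadder` closed in 12 and re-opened in 13; statements and proofs otherwise verbatim (K has no set_option / private / «[cite» token). `--supports stmt-Schanuel-33364`; rung 0 — nothing here proves Schanuel, 33364, 31077 or ThinFibre m₀ hypothesis-free.)
-/

/-!
# RootDecomp1KLevelFinite — lens 1, generation 51, node of record «THE x-LACUNARY DEGREE LADDER»: the thin-fibre
clause `ThinFibreAt m₀ P` HOLDS, hypothesis-free, as soon as `deg_Y P < γ·m₀`, where `γ` is the GAP BELOW THE TOP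
`x`-EXPONENT of `P` (`γ = 1`: the tree's degree ladder `RootDecomp1KDegreeLadder.thinFibreAt_of_natDegree_lt`)

(lens-1 g51 kernel L = HOME/decomp-schanuel-lens-1/g51/LacunaryLadder.lean, 2026-09-01; imports ONLY the tree:
`…RootDecomp1KLevelFinite09` (the ported K/K″ line, hence `…DegreeLadder09`: `specX`, `clearedEval`, `coeff_specX_bound_abs`,
`onCurve_exponent_ineq`, `ThinFibreAt`, `lineP`) and `…RootDecomp1KXAll03` (node 4's presentations `xPolyP k c` with
`coeff_coeff_xPolyP`, the thresholds `thinThreshold`); ONE new section §11.  PRICED EX ANTE by crit-1 (g9, bus L2519):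
×0-AS-RECORD under K-R36 (i) / K-R40 (viii) — a threshold function refined by the `x`-support on a sub-family; the record
gains new decided tuples at `m₀ = 2` inside the open territory of K-R40 (viii) (tops WITH `ℚ₂`-roots) and the sharper first
disjunct `deg_Y P < γ(P)·m₀` of `DecidedAt m₀`.  Rung 0; nothing summit-level.)

WHAT IS PROVED (hypothesis-free; 0 sorry; standard axioms).
* §11.1 `gap_tail`: the tail arithmetic — `2^{γ·N!} ≤ C₃·q^d` with `d < γ·m₀` forces `C·2^{(N+1)!} < q^{m₀·N}` beyond an
  explicit level (the tree's exponent bookkeeping run at the quality `min m₀ (d+1)`, closed by `onCurve_exponent_ineq`).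
* §11.2 `pow_dvd_coeff_of_root_gap`: GAUSS THROUGH A GAP — a rational root `p/D` (lowest terms) of `Q ∈ ℤ[x]` with
  `deg Q ≤ K` and no monomials of exponent strictly between `K − γ` and `K` forces `D^γ ∣ Q_K`.
* §11.3 two-term curves `twoTermP k B A = x^k·B(Y) − A(Y)` (`bev_twoTermP`, `coeff_twoTermP`, `coeff_coeff_twoTermP`,
  `natDegree_twoTermP(_le)`, `coeff_specX_twoTermP_eq_zero`) and the headline
  `thinFibreAt_twoTermP : 1 ≤ k → deg_Y (x^k·B(Y) − A(Y)) < k·m₀ → ThinFibreAt m₀ (x^k·B(Y) − A(Y))` for ALL `B, A ∈ ℤ[Y]`: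
  at a non-degenerate level point `(s_N, r)` the truncation `s_N = p_N/2^{N!}` (lowest terms, `p_N` odd — tree
  `coprime_psNumer_two_pow`) is a root of `specX P r = Q_k x^k + Q_0`, so `2^{k·N!} ∣ Q_k ≠ 0` and
  `2^{k·N!} ≤ |Q_k| ≤ C₃·den(r)^{deg_Y P}` (tree `coeff_specX_bound_abs`): the `x`-GAP FORCES THE HEIGHT of the level point,
  whichever 2-adic branch (near a root of the top, or `(∞, ∞)`) it lies on; `gap_tail` concludes.  `thinFibreAt_twoTermP_of_le`.
* §11.4 the general gap: `thinFibreAt_xPolyP_gap` — for `P = Σ_{j ≤ k} x^j c_j(Y)` with `c_j = 0` for `k − γ < j < k`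
  (`1 ≤ γ ≤ k`) and a top `c_k` WITHOUT RATIONAL ROOTS, `deg_Y P < γ·m₀ → ThinFibreAt m₀ P` (the top coefficient of
  `specX P r` is the cleared value `den(r)^d·c_k(r) ≠ 0`: `coeff_specX_xPolyP_top`, `coeff_specX_xPolyP_eq_zero`,
  `natDegree_top_le_natDegree_xPolyP`).
* §11.5 MEMBERS decided at `m₀ = 2` (and every `m₀ ≥ 2`), all of `x`-degree `≥ 2`, `Y`-degree `≥ 2`, top WITH roots in
  `ℚ ⊂ ℚ₂`: the elliptic member `ellP = x²·(Y³ − 25Y) − 1` (`W² = Y³ − 25Y`, rank one, in the coordinate `x = 1/W`;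
  `thinFibreAt_ellP`), the non-separable-top member `cuspTwoTermP = x²·(Y−1)²(Y+2) − 1` (`μ = 2`; `thinFibreAt_cuspTwoTermP`), the
  `x`-cubic member `quartP = x³·(Y⁴ + Y) − 2` (`thinFibreAt_quartP`); their `bev_*`, `natDegree_*`, rational points
  `ratPoint_*` (`(1/6, −4)`, `(1/2, 2)`, `(1, 1)`); and the POSITION of `ellP` BY NAME: `two_le_natDegree_ellP` (the degree
  ladder needs `m₀ ≥ 4`), `ellP_ne_xLinP` / `not_xLinearLt_ellP` (no x-linear presentation at all: not node 2's `XLinearLt`,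
  not `RootDecomp1KXLinearII`'s separable x-linear class), `three_le_thinThreshold_ellP` (`RootDecomp1KXAll.thinFibreAt_all`
  needs `m₀ ≥ 3`), `exists_padic_root_top_of_ellP_eq` (in EVERY presentation `ellP = xPolyP k c` the top `c_k` has a root in
  `ℚ₂`: ADDENDUM-3's rootless-top class does not contain it — the near-root branch is LIVE),
  `exists_real_fibre_point_ellP` (a real point on the fibre `x = ℓ₂`).
* §11.6 erratum in passing (asked by crit-1, L2519): `thinFibreAt_two_lineP : ThinFibreAt 2 lineP` and
  `thinFibreAt_lineP_of_two_le` — the line `(x − 1)·Y = 1` has `Y`-degree `1 < 2`, so the tree's degree ladder decides it at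
  every `m₀ ≥ 2` (the docstring of `RootDecomp1KXLinearII.thinFibreAt_lineP` calling `m₀ = 2` «Roth-critical, open» errs;
  `m₀ = 1` fails by the tree's `not_thinFibre_one`).

HONESTY.  Rung 0; ×0-as-record (priced ex ante).  The input is the K-line's own — exact 2-adic divisibility of the cleared
level identity and size counting (node 1) — read through the `x`-gap; `γ = 1` gains nothing; for fixed `(k, deg_Y P)` only the
qualities `m₀ > deg_Y P / k` are decided; the x-LINEAR curves (`k = 1`) of `Y`-degree `≥ 2` with tops having `ℚ₂`-roots
(e.g. `x·(Y² − 17) = 1` at `m₀ = 2`) are NOT touched.  Items 33364 / 33363 / 31077 (∀), the (b)-cell, `ThinFibre m₀`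
(`m₀ ≥ 2`), `_root_.Schanuel`, `SiegelShapes`, `SiegelShapesOff(At)`: OPEN; cite item wi-102309 load-bearing for the residual.
-/

noncomputable section

open Polynomial LiouvilleNumber
open scoped Nat
namespace Summit.Schanuel.Schanuel.Theorems.RootDecomp1KLevelFinite

open Summit.Schanuel.Schanuel.Theorems.RootDecomp1KTwoBaseCell (psNumer partialSum_eq_psNumer_div coprime_psNumer)
open Summit.Schanuel.Schanuel.Theorems.RootDecomp1KRelLiouvilleCell (partialSum_two_lt_liouvilleNumber
  liouvilleNumber_two_lt partialSum_two_zero)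
open Summit.Schanuel.Schanuel.Theorems.RootDecomp1KDegreeLadder
open Summit.Schanuel.Schanuel.Theorems.RootDecomp1KXLinear (xLinP bev_xLinP bev_map_C XLinearLt aeval_ratCast)
open Summit.Schanuel.Schanuel.Theorems.RootDecomp1KXTop (xPolyP bev_xPolyP)
open Summit.Schanuel.Schanuel.Theorems.RootDecomp1KXAll (thinThreshold coeff_coeff_xPolyP)

section LacunaryLadder

/-! ## §11  THE x-LACUNARY DEGREE LADDER

### §11.1  The tail arithmetic: `2^{γ·N!} ≤ C₃·q^d` with `d < γ·m₀` forces `C·2^{(N+1)!} < q^{m₀ N}` -/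

/-- `s_N = p_N / 2^{N!}` (tree `partialSum_eq_psNumer_div` at `b = 2`). -/
theorem lac_partialSum_two (N : ℕ) : partialSum 2 N = (psNumer 2 N : ℝ) / (2 : ℝ) ^ N ! := by
  have := partialSum_eq_psNumer_div (b := 2) (by norm_num) N
  simpa using this

/-- **The tail of the ladder, with a gap `γ`.**  If a height bound `2^{γ·N!} ≤ C₃·q^d` holds and `d < γ·m₀`, then
beyond an explicit level `C·2^{(N+1)!} < q^{m₀·N}` (`γ = 1` is the arithmetic of the tree's `lowDegree_clause`;
the proof is the same exponent bookkeeping run at the quality `min m₀ (d+1)` and closed by the tree's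
`onCurve_exponent_ineq`). -/
theorem gap_tail (C C₃ : ℝ) (hC₃0 : 0 < C₃) {γ d m₀ : ℕ} (hγ : 1 ≤ γ) (hm : d < γ * m₀) :
    ∃ N₀ : ℕ, ∀ N : ℕ, N₀ ≤ N → ∀ q : ℕ, 1 ≤ q →
      (2 : ℝ) ^ (γ * N !) ≤ C₃ * (q : ℝ) ^ d → C * 2 ^ (N + 1)! < (q : ℝ) ^ (m₀ * N) := by
  set B : ℝ := max C 1 + 1 with hB
  have hB0 : 0 < B := by have := le_max_right C 1; rw [hB]; linarith
  set L : ℕ := ⌈B + C₃⌉₊ + 2 with hL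
  have hCL : B + C₃ ≤ (2 : ℝ) ^ L := by
    have h1 : B + C₃ ≤ ⌈B + C₃⌉₊ := Nat.le_ceil _
    have h2 : ((⌈B + C₃⌉₊ + 2 : ℕ) : ℝ) ≤ (2 : ℝ) ^ (⌈B + C₃⌉₊ + 2) := by
      exact_mod_cast (Nat.lt_two_pow_self).le
    push_cast at h2; linarith
  have hBB : B ≤ (2 : ℝ) ^ L := by linarith
  have hBC₃ : C₃ ≤ (2 : ℝ) ^ L := by linarith
  refine ⟨L * (2 * d + 1) + d + 2, fun N hN q hq hV => ?_⟩
  have hqR1 : (1 : ℝ) ≤ q := by exact_mod_cast hq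
  have hNd : L * (2 * d + 1) + d + 1 ≤ N := by omega
  set W : ℝ := (2 : ℝ) ^ (N + 1)! with hW
  have hWpos : 0 < W := by positivity
  by_contra hsmall
  rw [not_lt] at hsmall
  rcases Nat.eq_zero_or_pos d with hd0 | hdpos
  · -- `Y`-degree 0: the height bound alone bounds the level
    rw [hd0, pow_zero, mul_one] at hV
    have h1 : (2 : ℝ) ^ (γ * N !) ≤ (2 : ℝ) ^ L := hV.trans hBC₃
    rw [pow_le_pow_iff_right₀ (by norm_num : (1 : ℝ) < 2)] at h1
    have h2 : N ≤ N ! := Nat.self_le_factorial N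
    have h3 : N ! ≤ γ * N ! := Nat.le_mul_of_pos_left _ hγ
    have hLN : L + 2 ≤ N := by rw [hd0] at hN; omega
    omega
  -- `Y`-degree `d ≥ 1`: run the bookkeeping at the quality `m₁ = min m₀ (d+1)`
  set m₁ : ℕ := min m₀ (d + 1) with hm₁
  have hm₁le : m₁ ≤ d + 1 := min_le_right _ _
  have hm₁m₀ : m₁ ≤ m₀ := min_le_left _ _
  have hγm₁ : d + 1 ≤ γ * m₁ := by
    rcases le_total m₀ (d + 1) with h | h
    · rw [hm₁, min_eq_left h]; omega
    · rw [hm₁, min_eq_right h]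
      calc d + 1 = 1 * (d + 1) := (one_mul _).symm
        _ ≤ γ * (d + 1) := Nat.mul_le_mul_right _ hγ
  set Qr : ℝ := (q : ℝ) ^ (m₁ * N) with hQr
  have hstar : Qr < B * W := by
    calc Qr ≤ (q : ℝ) ^ (m₀ * N) := pow_le_pow_right₀ hqR1 (Nat.mul_le_mul_right _ hm₁m₀)
      _ ≤ C * W := hsmall
      _ ≤ max C 1 * W := mul_le_mul_of_nonneg_right (le_max_left _ _) hWpos.le
      _ < B * W := by rw [hB]; nlinarith
  set V : ℝ := (2 : ℝ) ^ (γ * N !) with hVdef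
  have hVpos : 0 < V := by positivity
  have h1 : V ^ (m₁ * N) ≤ C₃ ^ (m₁ * N) * Qr ^ d := by
    calc V ^ (m₁ * N) ≤ (C₃ * (q : ℝ) ^ d) ^ (m₁ * N) := pow_le_pow_left₀ hVpos.le hV _
      _ = C₃ ^ (m₁ * N) * Qr ^ d := by
          rw [mul_pow, hQr, ← pow_mul, ← pow_mul, mul_comm d]
  have h2 : Qr ^ d < (B * W) ^ d := pow_lt_pow_left₀ hstar (by positivity) (by omega)
  have h3 : C₃ ^ (m₁ * N) ≤ ((2 : ℝ) ^ L) ^ (m₁ * N) := pow_le_pow_left₀ hC₃0.le hBC₃ _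
  have h4 : (B * W) ^ d ≤ ((2 : ℝ) ^ L * W) ^ d :=
    pow_le_pow_left₀ (by positivity) (mul_le_mul_of_nonneg_right hBB hWpos.le) _
  have h5 : V ^ (m₁ * N) < ((2 : ℝ) ^ L) ^ (m₁ * N) * ((2 : ℝ) ^ L) ^ d * W ^ d := by
    calc V ^ (m₁ * N) ≤ C₃ ^ (m₁ * N) * Qr ^ d := h1
      _ < C₃ ^ (m₁ * N) * (B * W) ^ d := mul_lt_mul_of_pos_left h2 (by positivity)
      _ ≤ ((2 : ℝ) ^ L) ^ (m₁ * N) * ((2 : ℝ) ^ L * W) ^ d :=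
          mul_le_mul h3 h4 (by positivity) (by positivity)
      _ = ((2 : ℝ) ^ L) ^ (m₁ * N) * ((2 : ℝ) ^ L) ^ d * W ^ d := by rw [mul_pow]; ring
  rw [hVdef, hW, ← pow_mul, ← pow_mul, ← pow_mul, ← pow_mul, ← pow_add, ← pow_add,
    pow_lt_pow_iff_right₀ (by norm_num : (1 : ℝ) < 2)] at h5
  have h6 : L * (m₁ * N) ≤ L * ((d + 1) * N) := Nat.mul_le_mul_left _ (Nat.mul_le_mul_right _ hm₁le)
  have h7 := onCurve_exponent_ineq hNd
  have h8 : N ! * ((d + 1) * N) ≤ γ * N ! * (m₁ * N) := by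
    calc N ! * ((d + 1) * N) ≤ N ! * ((γ * m₁) * N) := Nat.mul_le_mul_left _ (Nat.mul_le_mul_right _ hγm₁)
      _ = γ * N ! * (m₁ * N) := by ring
  have h9 : γ * N ! * (m₁ * N) < γ * N ! * (m₁ * N) :=
    calc γ * N ! * (m₁ * N) < L * (m₁ * N) + L * d + (N + 1)! * d := h5
      _ ≤ L * ((d + 1) * N) + L * d + (N + 1)! * d := by omega
      _ ≤ N ! * ((d + 1) * N) := h7
      _ ≤ γ * N ! * (m₁ * N) := h8
  exact lt_irrefl _ h9

/-! ### §11.2  Gauss through a gap: a rational root `p/D` (lowest terms) of `Q ∈ ℤ[x]` whose `x`-exponents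
jump from `≤ K − γ` straight to `K` forces `D^γ ∣ Q_K` -/

/-- **Gauss's lemma through a gap.**  If `Q ∈ ℤ[x]` has degree `≤ K`, no monomials of exponent strictly between
`K − γ` and `K`, and the rational root `p/D` with `gcd(D, p) = 1`, then `D^γ` divides the coefficient `Q_K`
(clear denominators by `D^K`: every lower monomial carries `D^{K−i}` with `K − i ≥ γ`). -/
theorem pow_dvd_coeff_of_root_gap (Q : ℤ[X]) {p : ℤ} {D : ℕ} (hD : 0 < D) (hcop : IsCoprime (D : ℤ) p)
    {K γ : ℕ} (hγK : γ ≤ K) (hdeg : Q.natDegree ≤ K) (hgap : ∀ i, K - γ < i → i < K → Q.coeff i = 0)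
    (hroot : aeval ((p : ℝ) / D) Q = 0) : (D : ℤ) ^ γ ∣ Q.coeff K := by
  have hc := clearedEval_cast Q p hD hdeg
  rw [hroot, mul_zero] at hc
  have hz : clearedEval Q p D K = 0 := by exact_mod_cast hc
  unfold clearedEval at hz
  rw [Finset.sum_range_succ, Nat.sub_self, pow_zero, mul_one] at hz
  have hdvd : (D : ℤ) ^ γ ∣ ∑ i ∈ Finset.range K, Q.coeff i * p ^ i * (D : ℤ) ^ (K - i) := by
    refine Finset.dvd_sum fun i hi => ?_
    have hi' : i < K := Finset.mem_range.mp hi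
    by_cases hgi : K - γ < i
    · rw [hgap i hgi hi', zero_mul, zero_mul]
      exact dvd_zero _
    · exact Dvd.dvd.mul_left (pow_dvd_pow (D : ℤ) (by omega : γ ≤ K - i)) _
  have htop : (D : ℤ) ^ γ ∣ Q.coeff K * p ^ K := by
    have : Q.coeff K * p ^ K = -(∑ i ∈ Finset.range K, Q.coeff i * p ^ i * (D : ℤ) ^ (K - i)) := by
      linarith
    rw [this]
    exact (dvd_neg).mpr hdvd
  exact (IsCoprime.pow hcop).dvd_of_dvd_mul_right htop

/-! ### §11.3  Two-term curves `x^k·B(Y) = A(Y)` -/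

/-- the TWO-TERM CURVE `x^k·B(Y) − A(Y) ∈ ℤ[x][Y]` (`x`-exponents `{0, k}` only: the gap below the top
`x`-exponent is `γ = k`). -/
def twoTermP (k : ℕ) (B A : ℤ[X]) : ℤ[X][X] :=
  Polynomial.map C B * C (X ^ k) - Polynomial.map C A

/-- `(x^k·B(Y) − A(Y))(x, y) = x^k·B(y) − A(y)`. -/
theorem bev_twoTermP (k : ℕ) (B A : ℤ[X]) (x y : ℝ) :
    bev (twoTermP k B A) x y = x ^ k * aeval y B - aeval y A := by
  rw [twoTermP, bev_sub, bev_mul, bev_map_C, bev_map_C, bev_C, map_pow, aeval_X]; ring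

/-- the `Y^j`-coefficient of the two-term curve: `B_j·x^k − A_j`. -/
theorem coeff_twoTermP (k : ℕ) (B A : ℤ[X]) (j : ℕ) :
    (twoTermP k B A).coeff j = C (B.coeff j) * X ^ k - C (A.coeff j) := by
  rw [twoTermP, coeff_sub, coeff_mul_C, coeff_map, coeff_map]

/-- … and its `x^i`-coefficient. -/
theorem coeff_coeff_twoTermP (k : ℕ) (B A : ℤ[X]) (j i : ℕ) :
    ((twoTermP k B A).coeff j).coeff i =
      (if i = k then B.coeff j else 0) - (if i = 0 then A.coeff j else 0) := by
  rw [coeff_twoTermP, coeff_sub, coeff_C_mul, coeff_X_pow, coeff_C]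
  simp only [mul_ite, mul_one, mul_zero]

/-- the `Y`-degree of the two-term curve is at most `max (deg B) (deg A)` … -/
theorem natDegree_twoTermP_le (k : ℕ) (B A : ℤ[X]) :
    (twoTermP k B A).natDegree ≤ max B.natDegree A.natDegree := by
  unfold twoTermP
  refine (natDegree_sub_le _ _).trans (max_le_max ?_ natDegree_map_le)
  refine natDegree_mul_le.trans ?_
  rw [natDegree_C, add_zero]
  exact natDegree_map_le

/-- … and equals `deg B` when `deg A < deg B`. -/
theorem natDegree_twoTermP {k : ℕ} {B A : ℤ[X]} (hB : B ≠ 0) (hAB : A.natDegree < B.natDegree) :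
    (twoTermP k B A).natDegree = B.natDegree := by
  apply le_antisymm
  · exact (natDegree_twoTermP_le k B A).trans (max_le le_rfl hAB.le)
  · apply le_natDegree_of_ne_zero
    rw [coeff_twoTermP, coeff_eq_zero_of_natDegree_lt hAB, map_zero, sub_zero]
    exact mul_ne_zero (C_ne_zero.mpr (leadingCoeff_ne_zero.mpr hB)) (pow_ne_zero _ X_ne_zero)

/-- the cleared specialisation `specX` of a two-term curve at `Y = r` has `x`-monomials of exponent `0` and `k`
only. -/
theorem coeff_specX_twoTermP_eq_zero (k : ℕ) (B A : ℤ[X]) (r : ℚ) {i : ℕ} (hi0 : i ≠ 0)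
    (hik : i ≠ k) : (specX (twoTermP k B A) r).coeff i = 0 := by
  rw [coeff_specX]
  refine Finset.sum_eq_zero fun j _ => ?_
  rw [coeff_coeff_twoTermP k, if_neg hik, if_neg hi0, sub_zero, zero_mul]

/-- **THE x-LACUNARY DEGREE LADDER for two-term curves** (hypothesis-free).  For `P = x^k·B(Y) − A(Y)`
(`k ≥ 1`, ANY `B, A ∈ ℤ[Y]`) the thin-fibre clause `ThinFibreAt m₀ P` holds at every quality `m₀` with
`deg_Y P < k·m₀` — the tree's degree ladder `thinFibreAt_of_natDegree_lt` (`deg_Y P < m₀`) is the case `k = 1`.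
MECHANISM: at a non-degenerate level point `(s_N, r)`, `s_N = p_N/2^{N!}` in lowest terms (`p_N` odd) is a root
of `specX P r = Q_k x^k + Q_0 ∈ ℤ[x]`; Gauss through the gap gives `2^{k·N!} ∣ Q_k ≠ 0`, so
`2^{k·N!} ≤ |Q_k| ≤ C₃·den(r)^{deg_Y P}` — the HEIGHT of the level point is FORCED up by the `x`-gap —, and the
tail arithmetic `gap_tail` concludes.  No localisation (the near-root and `(∞,∞)` branches are not
distinguished), no separability, no approximation theorem. -/
theorem thinFibreAt_twoTermP {k : ℕ} (hk : 1 ≤ k) (B A : ℤ[X]) {m₀ : ℕ}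
    (hm : (twoTermP k B A).natDegree < k * m₀) : ThinFibreAt m₀ (twoTermP k B A) := by
  classical
  intro C
  set P := twoTermP k B A with hPdef
  obtain ⟨C₃, hC₃0, hC₃⟩ := coeff_specX_bound_abs P (max C 1) (le_max_right _ _)
  obtain ⟨N₁, hN₁⟩ := gap_tail C C₃ hC₃0 hk hm
  refine ⟨max N₁ 2, fun N hN r hrC hA hx => ?_⟩
  obtain ⟨x, hx⟩ := hx
  have hspec0 : specX P r ≠ 0 := specX_ne_zero_of_bev_ne_zero hx
  have hN2 : 2 ≤ N := le_trans (le_max_right _ _) hN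
  have hNN₁ : N₁ ≤ N := le_trans (le_max_left _ _) hN
  set Q := specX P r with hQ
  -- the `x`-support of `Q` is `⊆ {0, k}`
  have hcoef : ∀ i, i ≠ 0 → i ≠ k → Q.coeff i = 0 := fun i hi0 hik =>
    coeff_specX_twoTermP_eq_zero k B A r hi0 hik
  have hdegQ : Q.natDegree ≤ k :=
    (natDegree_le_iff_coeff_eq_zero).mpr fun i hi => hcoef i (by omega) (by omega)
  -- the root `s_N = p_N / 2^{N!}` in lowest terms
  have hsNfrac : partialSum 2 N = (((psNumer 2 N : ℕ) : ℤ) : ℝ) / ((2 ^ N ! : ℕ) : ℝ) := by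
    rw [lac_partialSum_two]; push_cast; rfl
  have hcop : IsCoprime (((2 ^ N ! : ℕ) : ℤ)) (((psNumer 2 N : ℕ) : ℤ)) :=
    Nat.isCoprime_iff_coprime.mpr (coprime_psNumer_two_pow hN2 (N !))
  have hrootN : aeval ((((psNumer 2 N : ℕ) : ℤ) : ℝ) / ((2 ^ N ! : ℕ) : ℝ)) Q = 0 := by
    rw [← hsNfrac, hQ, aeval_specX, hA, mul_zero]
  -- Gauss through the gap: `(2^{N!})^k ∣ Q_k`
  have hdvd : (((2 ^ N ! : ℕ) : ℤ)) ^ k ∣ Q.coeff k :=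
    pow_dvd_coeff_of_root_gap Q (by positivity) hcop le_rfl hdegQ
      (fun i h1 h2 => hcoef i (by omega) (by omega)) hrootN
  -- `Q_k ≠ 0`: otherwise `Q` is the non-zero constant `Q_0`, which has no root
  have hqk : Q.coeff k ≠ 0 := by
    intro h0
    have hQC : Q = Polynomial.C (Q.coeff 0) := by
      ext i
      rcases Nat.eq_zero_or_pos i with rfl | hi
      · rw [coeff_C_zero]
      · rw [coeff_C, if_neg hi.ne']
        by_cases hik : i = k
        · rw [hik, h0]
        · exact hcoef i hi.ne' hik
    have hq0 : Q.coeff 0 ≠ 0 := by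
      intro h00
      apply hspec0
      rw [hQC, h00, map_zero]
    apply hq0
    have h := hrootN
    rw [hQC, aeval_C, algebraMap_int_eq, eq_intCast, Int.cast_eq_zero] at h
    exact h
  -- the forced height: `2^{k·N!} ≤ |Q_k| ≤ C₃·den(r)^{deg_Y P}`
  have hG : (((2 ^ N ! : ℕ) : ℤ)) ^ k ≤ |Q.coeff k| :=
    Int.le_of_dvd (abs_pos.mpr hqk) ((dvd_abs _ _).mpr hdvd)
  have hV : (2 : ℝ) ^ (k * N !) ≤ C₃ * (r.den : ℝ) ^ P.natDegree := by
    have h1 : (((((2 ^ N ! : ℕ) : ℤ)) ^ k : ℤ) : ℝ) ≤ ((|Q.coeff k| : ℤ) : ℝ) := by exact_mod_cast hG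
    have h2 : ((|Q.coeff k| : ℤ) : ℝ) ≤ C₃ * (r.den : ℝ) ^ P.natDegree := by
      rw [Int.cast_abs]; exact hC₃ r (hrC.trans (le_max_left _ _)) k
    have h3 : (((((2 ^ N ! : ℕ) : ℤ)) ^ k : ℤ) : ℝ) = (2 : ℝ) ^ (k * N !) := by
      push_cast; rw [← pow_mul, mul_comm]
    linarith
  exact hN₁ N hNN₁ r.den r.den_pos hV

/-- the clause at EVERY quality `m₀ ≥ ⌈(deg_Y P + 1)/k⌉`, monotonically. -/
theorem thinFibreAt_twoTermP_of_le {k : ℕ} (hk : 1 ≤ k) (B A : ℤ[X]) {m₀ m : ℕ}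
    (hm : (twoTermP k B A).natDegree < k * m₀) (hmm : m₀ ≤ m) : ThinFibreAt m (twoTermP k B A) :=
  thinFibreAt_twoTermP hk B A (lt_of_lt_of_le hm (Nat.mul_le_mul_left _ hmm))

end LacunaryLadder

end Summit.Schanuel.Schanuel.Theorems.RootDecomp1KLevelFinite

end
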